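import Summits.Schanuel.Schanuel.Theses.RealCoreRotationSplit
import Literature.NumberTheory.Transcendental.ZilberFieldExistenceProofs
import Literature.NumberTheory.Transcendental.ZilberClassHomogeneity
import Literature.NumberTheory.Transcendental.EclPredim
import Literature.NumberTheory.Transcendental.ZilberFieldQuasiminimal
import Literature.NumberTheory.Transcendental.GammaFieldsEcl
import Literature.NumberTheory.Transcendental.GammaIsoTransfer
import Literature.Combinatorics.Matroid.RelRankFinitary

/-!
# Disproof of `RelOverRealCore` — findings: NO KILL POSSIBLE (`S → C` proved); `S ↔ SC_P ∧ C`; `C` blind to the core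

Crux-attack at birth (refuter, stmt-Schanuel-19277, route-Schanuel-RealCoreRotationSplit,
2026-08-17). Verdict: SURVIVES. The crux `C = RelOverRealCore` is implied by the summit
`S = Schanuel` (theorem `relOverRealCore_of_schanuel` below), so an unconditional `¬C` would be
`¬Schanuel`; no `_false_without_` lemma applies (the crux has a single hypothesis, `ℚ`-freeness
modulo `span_ℚ Pc`, and dropping it is trivially false at `z = 0`, `n = 1`). Elaboration: rc 0,
body `↔ ∀ n z, LinearIndependent ℚ (mkQ ∘ z) → n ≤ relTrdeg Pc z` by `Iff.rfl`; non-vacuous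
(`z = ![I]`); `n = 0` trivial; tactic sweep (simp/aesop/exact?/norm_num/positivity) fails; no finite
or decidable instance (hardness floor at `n = 1`: `z = iπ` needs `π ∉ ℚ(P)^alg ∋ e`, i.e. at least
the algebraic independence of `e, π`).

## Original probe notes

`Schanuel → RelOverRealCore`: the crux is a CONSEQUENCE of the summit (so it cannot be refuted
without refuting Schanuel's conjecture). Proof (cofinal tightness of the real core): under SC the
zero subspace is strong (`schanuelProperty_iff_isStrong_bot`); every point of `P = ecl^ℝ(∅)` is
a coordinate of a real Khovanskii point, whose complex image is a complex Khovanskii point over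
`∅`, hence spans a subspace of `span_ℚ Pc` of predimension `≤ 0` over `⊥`
(`predim_span_le_zero_of_khovanskii`); by submodularity finite unions of such pieces have
predimension `0`, so they are strong (`IsStrong.of_predim_eq_zero`); by finitarity of the
algebraic matroid the predimension of a finite tuple over `span_ℚ Pc` is already its predimension
over such a piece, so `span_ℚ Pc` is strong; strongness of `span_ℚ Pc` is exactly
`RelOverRealCore` through the bridges `td = relRank = toENat relTrdeg`.

## Findings (all sorry-free, axioms `propext, Classical.choice, Quot.sound`)
* `relOverRealCore_of_schanuel : Schanuel → RelOverRealCore` — S → C; no unconditional `¬C`.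
* `schanuel_iff_split : Schanuel ↔ SchanuelOnRealCore ∧ RelOverRealCore` — the summit splits
  EXACTLY at the core: `SchanuelOnRealCore` (SC_P) = Schanuel for `ℚ`-free real tuples inside
  `P` (what the route's residual `RealSchanuel` is actually used for); hence
  `crux_imp_summit_iff : (C → S) ↔ (C → SC_P)`.
* `core_translate_invariant` / `relOverRealCore_instance_translate` — both sides of `C` are
  invariant under `z ↦ z + a` for core tuples `a ∈ P^n`: `C` sees `P` only through the base field
  `ℚ(P)` and is blind to algebraic relations among core points (the content of SC_P, which
  contains e.g. the algebraic independence of `e, e^e, e^{e^e}`); no derivation `C → SC_P` found,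
  so `C` does not (visibly) restate `S`.
-/

set_option linter.dupNamespace false

noncomputable section

open Set
open Literature.NumberTheory.Transcendental Literature.NumberTheory.Transcendental.GammaField
open Literature.NumberTheory.Transcendental.ZilberSaturationMain
open Literature.ModelTheory.ExponentialFields Literature.ModelTheory.ExponentialFields.ExponentialRing

namespace Summit.Schanuel.Schanuel.Cruxes.RelOverRealCore.Disproof

/-- The complex image `Pc` of the real core `P = ecl^ℝ(∅)`. -/
def coreC : Set ℂ := Complex.ofReal '' ecl (∅ : Set ℝ)

/-- Its `ℚ`-span (equal to `Pc` as a set, `coe_coreSpan`). -/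
def coreSpan : Submodule ℚ ℂ := Submodule.span ℚ coreC

theorem mem_coreC_of_mem_coreSpan {w : ℂ} (hw : w ∈ coreSpan) : w ∈ coreC := by
  induction hw using Submodule.span_induction with
  | mem w hw => exact hw
  | zero => exact ⟨0, (Khovanskii.eclSubfield (∅ : Set ℝ)).zero_mem, Complex.ofReal_zero⟩
  | add u v _ _ hu hv =>
    obtain ⟨a, ha, rfl⟩ := hu
    obtain ⟨b, hb, rfl⟩ := hv
    exact ⟨a + b, (Khovanskii.eclSubfield (∅ : Set ℝ)).add_mem ha hb, Complex.ofReal_add a b⟩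
  | smul q u _ hu =>
    obtain ⟨a, ha, rfl⟩ := hu
    refine ⟨(q : ℝ) * a, (Khovanskii.eclSubfield (∅ : Set ℝ)).mul_mem
      (SubfieldClass.ratCast_mem _ q) ha, ?_⟩
    rw [Rat.smul_def, Complex.ofReal_mul, Complex.ofReal_ratCast]

theorem coe_coreSpan : (coreSpan : Set ℂ) = coreC :=
  Subset.antisymm (fun _ hw => mem_coreC_of_mem_coreSpan hw) Submodule.subset_span

theorem exp_mem_coreC {w : ℂ} (hw : w ∈ coreC) : Complex.exp w ∈ coreC := by
  obtain ⟨a, ha, rfl⟩ := hw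
  exact ⟨Real.exp a, Khovanskii.exp_mem_ecl ha, Complex.ofReal_exp a⟩

theorem gens_coreSpan : gens coreSpan = coreC := by
  refine Subset.antisymm ?_ fun w hw => subset_gens coreSpan (by rw [coe_coreSpan]; exact hw)
  rintro w (hw | ⟨u, hu, rfl⟩)
  · exact mem_coreC_of_mem_coreSpan hw
  · exact exp_mem_coreC (mem_coreC_of_mem_coreSpan hu)

theorem gens_subset_coreC {W : Submodule ℚ ℂ} (hW : W ≤ coreSpan) : gens W ⊆ coreC := by
  rw [← gens_coreSpan]; exact gens_mono hW

/-- Every point of the core is a coordinate of a finite tuple of core points of predimension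
`≤ 0` over `⊥` (the complex image of a real Khovanskii point). -/
theorem exists_tuple_predim_le_zero {d : ℂ} (hd : d ∈ coreC) :
    ∃ (m : ℕ) (y : Fin m → ℂ), d ∈ range y ∧ (∀ j, y j ∈ coreC) ∧
      predim (⊥ : Submodule ℚ ℂ) (Submodule.span ℚ (range y)) ≤ 0 := by
  classical
  obtain ⟨a, ha, rfl⟩ := hd
  obtain ⟨n, x, f, ⟨i, hi⟩, hcoeff, heval, hdet⟩ := ha
  have hsol : Khovanskii.IsSol (∅ : Set ℝ) x f :=
    ⟨fun i => Khovanskii.mem_polyOver_iff.mpr (hcoeff i), heval, hdet⟩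
  have hsol' := hsol.map ExponentialRingHom.realComplex
  have hS : (ExponentialRingHom.realComplex '' (∅ : Set ℝ)) ⊆
      ((fieldOf (⊥ : Submodule ℚ ℂ) : IntermediateField ℚ ℂ) : Set ℂ) := by
    rw [image_empty]; exact empty_subset _
  have hδ := predim_span_le_zero_of_khovanskii (⊥ : Submodule ℚ ℂ) hS
    (fun i => Khovanskii.mem_polyOver_iff.mp (hsol'.coeff i)) hsol'.eval_eq hsol'.det_ne
  have hx : (⇑ExponentialRingHom.realComplex ∘ x) = fun j => (x j : ℂ) := rfl
  rw [hx] at hδ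
  exact ⟨n, fun j => (x j : ℂ), ⟨i, by simp [hi]⟩,
    fun j => ⟨x j, ⟨n, x, f, ⟨j, rfl⟩, hcoeff, heval, hdet⟩, rfl⟩, hδ⟩

/-- Subadditivity of `δ(·/⊥)` when `⊥` is strong. -/
theorem predim_bot_sup_le (hbot : IsStrong (⊥ : Submodule ℚ ℂ)) {X Y : Submodule ℚ ℂ}
    (hX : IsFG ⊥ X) (hY : IsFG ⊥ Y) :
    predim ⊥ (X ⊔ Y) ≤ predim ⊥ X + predim ⊥ Y := by
  have h1 := predim_add (bot_le : (⊥ : Submodule ℚ ℂ) ≤ Y) (le_sup_right : Y ≤ X ⊔ Y) (hX.sup hY)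
  have h2 := predim_sup_le X Y (hX.of_le_left bot_le)
  have h3 := predim_add (bot_le : (⊥ : Submodule ℚ ℂ) ≤ X ⊓ Y) (inf_le_left : X ⊓ Y ≤ X) hX
  have h4 : 0 ≤ predim ⊥ (X ⊓ Y) := hbot bot_le (hX.mono inf_le_left)
  linarith

/-- Finite subsets of the core sit in finitely generated subspaces of the core of predimension
`0` over `⊥`. -/
theorem exists_fg_predim_eq_zero (hbot : IsStrong (⊥ : Submodule ℚ ℂ)) (s : Finset ℂ)
    (hs : (s : Set ℂ) ⊆ coreC) :
    ∃ W : Submodule ℚ ℂ, Submodule.span ℚ (s : Set ℂ) ≤ W ∧ W ≤ coreSpan ∧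
      IsFG ⊥ W ∧ predim ⊥ W = 0 := by
  classical
  induction s using Finset.induction_on with
  | empty => exact ⟨⊥, by simp, bot_le, isFG_self ⊥, predim_self ⊥⟩
  | insert d s hds ih =>
    obtain ⟨W, hsW, hWc, hfgW, hW0⟩ := ih fun w (hw : w ∈ (s : Set ℂ)) =>
      hs (Finset.mem_coe.2 (Finset.mem_insert_of_mem (Finset.mem_coe.1 hw)))
    obtain ⟨m, y, hdy, hyc, hδ⟩ :=
      exists_tuple_predim_le_zero (hs (Finset.mem_coe.2 (Finset.mem_insert_self d s)))
    set E : Submodule ℚ ℂ := Submodule.span ℚ (range y) with hE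
    have hfgE : IsFG ⊥ E := isFG_span_of_finite ⊥ (finite_range y)
    refine ⟨E ⊔ W, ?_, ?_, hfgE.sup hfgW, le_antisymm ?_ (hbot bot_le (hfgE.sup hfgW))⟩
    · rw [Finset.coe_insert, Submodule.span_insert]
      exact sup_le_sup (Submodule.span_le.2 (singleton_subset_iff.2 (Submodule.subset_span hdy)))
        hsW
    · exact sup_le (Submodule.span_le.2 (range_subset_iff.2 fun j => Submodule.subset_span (hyc j)))
        hWc
    · calc predim ⊥ (E ⊔ W) ≤ predim ⊥ E + predim ⊥ W := predim_bot_sup_le hbot hfgE hfgW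
        _ ≤ 0 := by rw [hW0, add_zero]; exact hδ

/-- `td Λ (span s) = rk((s, exp s)/gens Λ)` (set version of `td_span_range_eq_relRank`). -/
theorem td_span_eq_relRank' (Λ : Submodule ℚ ℂ) (s : Set ℂ) :
    td Λ (Submodule.span ℚ s) = (algMatroid ℂ).relRank (gens Λ) (s ∪ exp '' s) := by
  refine le_antisymm (td_span_le_relRank Λ s) ?_
  calc (algMatroid ℂ).relRank (gens Λ) (s ∪ exp '' s)
      ≤ (algMatroid ℂ).relRank (gens Λ) (gens (Λ ⊔ Submodule.span ℚ s)) := by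
        refine (algMatroid ℂ).relRank_mono_right _ ?_
        rintro b (hb | ⟨c, hc, rfl⟩)
        · exact mem_gens_of_mem (Submodule.mem_sup_right (Submodule.subset_span hb))
        · exact exp_mem_gens (Submodule.mem_sup_right (Submodule.subset_span hc))
    _ = td Λ (Submodule.span ℚ s) := by rw [← td_def, td_sup_left]

/-- Cofinal tightness: if `⊥` is strong then so is `span_ℚ Pc`. -/
theorem isStrong_coreSpan (hbot : IsStrong (⊥ : Submodule ℚ ℂ)) : IsStrong coreSpan := by
  classical
  rw [isStrong_iff_finset]
  intro s
  set Y : Submodule ℚ ℂ := Submodule.span ℚ (s : Set ℂ) with hY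
  -- finitarity: the rank over the core is attained over a finite subset `C₀` of the core
  obtain ⟨C₀, hC₀sub, hC₀fin, hC₀eq⟩ :=
    (algMatroid ℂ).exists_finite_subset_relRank_eq_of_ground_eq_univ rfl (C := gens coreSpan)
      (X := (s : Set ℂ) ∪ exp '' (s : Set ℂ)) (s.finite_toSet.union (s.finite_toSet.image _))
  rw [gens_coreSpan] at hC₀sub hC₀eq
  -- generators of `Y ⊓ coreSpan`
  haveI : FiniteDimensional ℚ Y := FiniteDimensional.span_of_finite ℚ s.finite_toSet
  haveI : FiniteDimensional ℚ ↥(Y ⊓ coreSpan) := Submodule.finiteDimensional_of_le inf_le_left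
  have hfgYΛ : (Y ⊓ coreSpan).FG := Submodule.FG.of_finite
  obtain ⟨t, ht⟩ := hfgYΛ
  have htc : (t : Set ℂ) ⊆ coreC := fun w hw => by
    have : w ∈ Y ⊓ coreSpan := ht ▸ Submodule.subset_span hw
    exact mem_coreC_of_mem_coreSpan this.2
  -- a strong finitely generated piece `W` of the core containing `t` and `C₀`
  obtain ⟨W, hW1, hW2, hfgW, hW0⟩ := exists_fg_predim_eq_zero hbot (t ∪ hC₀fin.toFinset) (by
    intro w hw
    rw [Finset.coe_union, Finite.coe_toFinset] at hw
    exact hw.elim (fun h => htc h) (fun h => hC₀sub h))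
  have hWstrong : IsStrong W := hbot.of_predim_eq_zero bot_le hfgW hW0
  have htW : Y ⊓ coreSpan ≤ W := by
    rw [← ht]
    refine (Submodule.span_mono ?_).trans hW1
    rw [Finset.coe_union]
    exact subset_union_left
  have hC₀W : C₀ ⊆ (W : Set ℂ) := fun c hc =>
    hW1 (Submodule.subset_span (by rw [Finset.coe_union, Finite.coe_toFinset]; exact Or.inr hc))
  -- linear dimensions agree
  have hldim : ldim coreSpan Y = ldim W Y := by
    rw [ldim_eq_ldim_inf Y coreSpan, ldim_eq_ldim_inf Y W]
    have : Y ⊓ coreSpan = Y ⊓ W :=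
      le_antisymm (le_inf inf_le_left htW) (inf_le_inf_left Y hW2)
    rw [this]
  -- transcendence degrees agree
  have htd : td coreSpan Y = td W Y := by
    rw [hY, td_span_eq_relRank', td_span_eq_relRank', gens_coreSpan]
    refine le_antisymm ((algMatroid ℂ).relRank_anti_left _ (gens_subset_coreC hW2)) ?_
    rw [← hC₀eq]
    exact (algMatroid ℂ).relRank_anti_left _ (hC₀W.trans (subset_gens W))
  have hpd : predim coreSpan Y = predim W Y := by rw [predim_def, predim_def, hldim, htd]
  rw [hpd]
  exact (isStrong_iff.1 hWstrong) Y (isFG_span_of_finite W s.finite_toSet)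

/-- **`S → C`**: Schanuel's conjecture implies the crux `RelOverRealCore`. -/
theorem relOverRealCore_of_schanuel (hS : _root_.Schanuel) :
    Summit.Schanuel.Schanuel.Theses.RealCoreRotationSplit.RelOverRealCore := by
  classical
  have hSP : SchanuelProperty ℂ := hS
  have hbot : IsStrong (⊥ : Submodule ℚ ℂ) := schanuelProperty_iff_isStrong_bot.1 hSP
  have hΛ := isStrong_coreSpan hbot
  intro n z hz
  change (n : Cardinal) ≤ relTrdeg coreC z
  have hli : LinIndepOver coreSpan z := (linIndepOver_iff _ _).2 hz
  have hfg : IsFG coreSpan (Submodule.span ℚ (range z)) := isFG_span_of_finite _ (finite_range z)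
  have hδ := (isStrong_iff.1 hΛ) _ hfg
  have hldim := ldim_span_eq_of_linIndepOver hli
  have htd : (n : ℕ∞) ≤ td coreSpan (Submodule.span ℚ (range z)) := by
    rw [predim_def, hldim] at hδ
    have h1 : n ≤ (td coreSpan (Submodule.span ℚ (range z))).toNat := by omega
    rw [← ENat.coe_toNat (td_ne_top hfg)]
    exact_mod_cast h1
  rw [td_span_range_eq_relRank, gens_coreSpan, range_gammaPt, ← range_comp,
    ← toENat_relTrdeg_eq_relRank] at htd
  exact Cardinal.natCast_le_toENat.1 htd

#print axioms relOverRealCore_of_schanuel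

/-! ### The `C → S` probe: `S ↔ SC_P ∧ C`, so `C → S` iff `C → SC_P`

`SchanuelOnRealCore` (SC_P) is Schanuel's conjecture restricted to `ℚ`-linearly independent REAL
tuples inside the core `P = ecl^ℝ(∅)` (it contains e.g. the algebraic independence of `e, e^e`).
The route's deciding theorem only ever uses its residual `RealSchanuel = SchanuelProperty ℝ` on
such tuples, so `S ↔ SC_P ∧ C` (`schanuel_iff_split`): the crux `C` restates the summit iff it
proves SC_P, a statement about tuples INSIDE `P` on which `C` (tuples free modulo `P`) is silent. -/

/-- Schanuel's conjecture for `ℚ`-linearly independent real tuples inside `P = ecl^ℝ(∅)`. -/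
def SchanuelOnRealCore : Prop :=
  ∀ (n : ℕ) (l : Fin n → ℝ), (∀ i, l i ∈ ecl (∅ : Set ℝ)) → LinearIndependent ℚ l →
    (n : Cardinal) ≤ Algebra.trdeg ℚ
      ↥(IntermediateField.adjoin ℚ (range l ∪ range (Real.exp ∘ l)))

theorem schanuelOnRealCore_of_schanuel (hS : _root_.Schanuel) : SchanuelOnRealCore :=
  fun n l _ hl => schanuelProperty_real_of_complex_holds hS n l hl

/-- The route's engine with the residual weakened to SC_P (proof = the deciding theorem `closes`,
verbatim, with `hIn0` applied only to core tuples). -/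
theorem schanuel_of_split (hIn0 : SchanuelOnRealCore)
    (hOut0 : Summit.Schanuel.Schanuel.Theses.RealCoreRotationSplit.RelOverRealCore) :
    _root_.Schanuel := by
  classical
  show ∀ (n : ℕ) (x : Fin n → ℂ), LinearIndependent ℚ x →
    (n : Cardinal) ≤ Algebra.trdeg ℚ ↥(IntermediateField.adjoin ℚ (Set.range x ∪ Set.range (Complex.exp ∘ x)))
  intro n x hx
  set P : Set ℝ := Literature.NumberTheory.Transcendental.ecl (∅ : Set ℝ) with hP
  set Pc : Set ℂ := Complex.ofReal '' P with hPc
  set E : Submodule ℚ ℂ := Submodule.span ℚ Pc with hE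
  set L : IntermediateField ℚ ℂ := IntermediateField.adjoin ℚ Pc with hL
  have hPexp : ∀ a ∈ P, Real.exp a ∈ P := fun a ha =>
    Literature.NumberTheory.Transcendental.Khovanskii.exp_mem_ecl ha
  have hPsub : ∀ w ∈ E, w ∈ Pc := fun w hw => mem_coreC_of_mem_coreSpan hw
  have hEL : ∀ w ∈ E, w ∈ L ∧ Complex.exp w ∈ L := by
    intro w hw
    obtain ⟨a, ha, rfl⟩ := hPsub w hw
    exact ⟨IntermediateField.subset_adjoin ℚ Pc ⟨a, ha, rfl⟩,
      IntermediateField.subset_adjoin ℚ Pc ⟨Real.exp a, hPexp a ha, Complex.ofReal_exp a⟩⟩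
  -- INSIDE count: only core tuples are fed to `hIn0`
  have hIn : ∀ (k : ℕ) (y : Fin k → ℂ), (∀ i, y i ∈ E) → LinearIndependent ℚ y →
      (k : Cardinal) ≤ Algebra.trdeg ℚ ↥(IntermediateField.adjoin ℚ (Set.range y ∪ Set.range (Complex.exp ∘ y))) := by
    intro k y hyE hyli
    choose l hlP hly using fun i => hPsub _ (hyE i)
    have hy : y = fun i => ((l i : ℝ) : ℂ) := funext fun i => (hly i).symm
    subst hy
    have hl : LinearIndependent ℚ l :=
      LinearIndependent.of_comp
        (Literature.ModelTheory.ExponentialFields.ExponentialRingHom.realComplex.toRingHom.toRatAlgHom.toLinearMap) hyli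
    -- `Real.exp = ExponentialRing.exp` on `ℝ` definitionally; restate `hIn0` in the class spelling
    have h1 : (k : Cardinal) ≤ Algebra.trdeg ℚ
        ↥(IntermediateField.adjoin ℚ (range l ∪ range (ExponentialRing.exp ∘ l))) := hIn0 k l hlP hl
    have h2 := Literature.ModelTheory.ExponentialFields.ExponentialRingHom.realComplex.lift_trdeg_adjoin_eq l
    simp only [Cardinal.lift_id] at h2
    rw [h2] at h1
    exact h1
  set V : Submodule ℚ ℂ := Submodule.span ℚ (Set.range x) with hV
  haveI : FiniteDimensional ℚ V := FiniteDimensional.span_of_finite ℚ (Set.finite_range x)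
  obtain ⟨U', hU'⟩ := (V ⊓ E).exists_isCompl
  set W : Submodule ℚ ℂ := V ⊓ E
  set U : Submodule ℚ ℂ := V ⊓ U' with hU
  haveI : FiniteDimensional ℚ W := Submodule.finiteDimensional_of_le inf_le_left
  haveI : FiniteDimensional ℚ U := Submodule.finiteDimensional_of_le inf_le_left
  have hsup : W ⊔ U = V := by
    rw [hU, inf_comm, ← sup_inf_assoc_of_le U' (inf_le_left : W ≤ V), hU'.sup_eq_top, top_inf_eq]
  have hdj : Disjoint W U := hU'.disjoint.mono_right inf_le_right
  have hUE : Disjoint U E := by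
    rw [Submodule.disjoint_def]
    intro a haU haE
    exact (Submodule.disjoint_def.mp hdj) a ⟨inf_le_left (b := U') haU, haE⟩ haU
  set k := Module.finrank ℚ W
  set m := Module.finrank ℚ U
  have hn : k + m = n := by
    have h1 := Submodule.finrank_sup_add_finrank_inf_eq W U
    rw [hdj.eq_bot, finrank_bot, add_zero, hsup, hV, finrank_span_eq_card hx, Fintype.card_fin] at h1
    exact h1.symm
  let bW := Module.finBasis ℚ W
  let bU := Module.finBasis ℚ U
  let y : Fin k → ℂ := fun i => bW i
  let z : Fin m → ℂ := fun j => bU j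
  have hyli : LinearIndependent ℚ y := bW.linearIndependent.map' W.subtype W.ker_subtype
  have hzli : LinearIndependent ℚ z := bU.linearIndependent.map' U.subtype U.ker_subtype
  have hyE : ∀ i, y i ∈ E := fun i => (bW i).2.2
  have hyV : ∀ i, y i ∈ V := fun i => (bW i).2.1
  have hzU : ∀ j, z j ∈ U := fun j => (bU j).2
  have hzV : ∀ j, z j ∈ V := fun j => inf_le_left (b := U') (hzU j)
  choose Ny hNy hNy_mem using fun i =>
    Literature.NumberTheory.Transcendental.exists_nsmul_mem_span_int x (hyV i)
  choose Nz hNz hNz_mem using fun j =>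
    Literature.NumberTheory.Transcendental.exists_nsmul_mem_span_int x (hzV j)
  let cy : Fin k → ℚˣ := fun i => Units.mk0 (Ny i : ℚ) (Nat.cast_ne_zero.mpr (hNy i))
  let cz : Fin m → ℚˣ := fun j => Units.mk0 (Nz j : ℚ) (Nat.cast_ne_zero.mpr (hNz j))
  let y' : Fin k → ℂ := fun i => (Ny i : ℚ) • y i
  let z' : Fin m → ℂ := fun j => (Nz j : ℚ) • z j
  have hy'_eq : cy • y = y' := by
    funext i; simp only [Pi.smul_apply', cy, y', Units.smul_def, Units.val_mk0]
  have hz'_eq : cz • z = z' := by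
    funext j; simp only [Pi.smul_apply', cz, z', Units.smul_def, Units.val_mk0]
  have hy'li : LinearIndependent ℚ y' := hy'_eq ▸ hyli.units_smul cy
  have hz'li : LinearIndependent ℚ z' := hz'_eq ▸ hzli.units_smul cz
  have hy'E : ∀ i, y' i ∈ E := fun i => E.smul_mem _ (hyE i)
  have hz'U : ∀ j, z' j ∈ U := fun j => U.smul_mem _ (hzU j)
  have hz'modE : LinearIndependent ℚ (E.mkQ ∘ z') := by
    refine hz'li.map ?_
    rw [Submodule.ker_mkQ]
    exact hUE.mono_left (Submodule.span_le.mpr (Set.range_subset_iff.mpr hz'U))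
  set Sy : Set ℂ := Set.range y' ∪ Set.range (Complex.exp ∘ y') with hSy
  set Sz : Set ℂ := Set.range z' ∪ Set.range (Complex.exp ∘ z') with hSz
  set Ky : IntermediateField ℚ ℂ := IntermediateField.adjoin ℚ Sy with hKy
  have hk : (k : Cardinal) ≤ Algebra.trdeg ℚ Ky := hIn k y' hy'E hy'li
  have hm₀ : (m : Cardinal) ≤ Algebra.trdeg L (IntermediateField.adjoin L Sz) := hOut0 m z' hz'modE
  have hKyL : Ky ≤ L := by
    rw [hKy, IntermediateField.adjoin_le_iff]
    rintro a (⟨i, rfl⟩ | ⟨i, rfl⟩)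
    · exact (hEL _ (hy'E i)).1
    · exact (hEL _ (hy'E i)).2
  have hm : (m : Cardinal) ≤ Algebra.trdeg Ky (IntermediateField.adjoin Ky Sz) :=
    hm₀.trans (Literature.NumberTheory.Transcendental.trdeg_adjoin_le_of_le hKyL Sz)
  have hkm : (k : Cardinal) + (m : Cardinal) ≤
      Algebra.trdeg ℚ (IntermediateField.adjoin ℚ (Sy ∪ Sz)) :=
    Literature.NumberTheory.Transcendental.add_le_trdeg_adjoin_union Sy Sz hk hm
  set Kx : IntermediateField ℚ ℂ :=
    IntermediateField.adjoin ℚ (Set.range x ∪ Set.range (Complex.exp ∘ x)) with hKx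
  have hle : IntermediateField.adjoin ℚ (Sy ∪ Sz) ≤ Kx := by
    rw [IntermediateField.adjoin_le_iff]
    rintro a ((⟨i, rfl⟩ | ⟨i, rfl⟩) | (⟨j, rfl⟩ | ⟨j, rfl⟩))
    · exact (Literature.NumberTheory.Transcendental.mem_adjoin_of_mem_span_int x (hNy_mem i)).1
    · exact (Literature.NumberTheory.Transcendental.mem_adjoin_of_mem_span_int x (hNy_mem i)).2
    · exact (Literature.NumberTheory.Transcendental.mem_adjoin_of_mem_span_int x (hNz_mem j)).1
    · exact (Literature.NumberTheory.Transcendental.mem_adjoin_of_mem_span_int x (hNz_mem j)).2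
  have hfin : Algebra.trdeg ℚ (IntermediateField.adjoin ℚ (Sy ∪ Sz)) ≤ Algebra.trdeg ℚ Kx :=
    trdeg_le_of_injective (IntermediateField.inclusion hle) (IntermediateField.inclusion_injective hle)
  calc (n : Cardinal) = (k : Cardinal) + (m : Cardinal) := by rw [← hn, Nat.cast_add]
    _ ≤ Algebra.trdeg ℚ (IntermediateField.adjoin ℚ (Sy ∪ Sz)) := hkm
    _ ≤ Algebra.trdeg ℚ Kx := hfin

/-- **`S ↔ SC_P ∧ C`**: the summit splits EXACTLY into Schanuel-on-the-core and the crux. -/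
theorem schanuel_iff_split :
    _root_.Schanuel ↔ SchanuelOnRealCore ∧
      Summit.Schanuel.Schanuel.Theses.RealCoreRotationSplit.RelOverRealCore :=
  ⟨fun hS => ⟨schanuelOnRealCore_of_schanuel hS, relOverRealCore_of_schanuel hS⟩,
    fun h => schanuel_of_split h.1 h.2⟩

/-- Hence the crux restates the summit iff it proves Schanuel on the core. -/
theorem crux_imp_summit_iff :
    (Summit.Schanuel.Schanuel.Theses.RealCoreRotationSplit.RelOverRealCore → _root_.Schanuel) ↔
      (Summit.Schanuel.Schanuel.Theses.RealCoreRotationSplit.RelOverRealCore → SchanuelOnRealCore) :=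
  ⟨fun h hC => (schanuel_iff_split.1 (h hC)).1, fun h hC => schanuel_of_split (h hC) hC⟩

/-- The route's residual is likewise only needed on the core: `RealSchanuel → SC_P`. -/
theorem schanuelOnRealCore_of_realSchanuel
    (h : Summit.Schanuel.Schanuel.Theses.RealCoreRotationSplit.RealSchanuel) : SchanuelOnRealCore :=
  fun n l _ hl => h n l hl

#print axioms schanuel_iff_split

/-! ### `C` is blind to the core: invariance under translation by core tuples

For a core tuple `a ∈ P^n`, the hypothesis (`z` free modulo `span_ℚ Pc`) and the conclusion
(`trdeg` of `L(z, e^z)` over `L = ℚ(Pc)`) of `C` at `z + a` are LITERALLY those at `z`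
(`L ∋ a_j, e^{± a_j}`). So `C` sees `P` only through the base field `ℚ(P)` and carries no
information about algebraic relations among core points — which is exactly the content of SC_P.
This is the structural reason no derivation `C → SC_P` (hence `C → S`) is available. -/

/-- `L = ℚ(Pc)`. -/
def coreField : IntermediateField ℚ ℂ := IntermediateField.adjoin ℚ coreC

theorem adjoin_translate_le (L : IntermediateField ℚ ℂ) {n : ℕ} (z w : Fin n → ℂ)
    (hw : ∀ i, w i ∈ L ∧ Complex.exp (w i) ∈ L) :
    IntermediateField.adjoin L (range (z + w) ∪ range (Complex.exp ∘ (z + w))) ≤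
      IntermediateField.adjoin L (range z ∪ range (Complex.exp ∘ z)) := by
  set K := IntermediateField.adjoin L (range z ∪ range (Complex.exp ∘ z))
  have hL : ∀ c ∈ L, c ∈ K := fun c hc => K.algebraMap_mem (⟨c, hc⟩ : L)
  rw [IntermediateField.adjoin_le_iff]
  rintro c (⟨i, rfl⟩ | ⟨i, rfl⟩)
  · exact K.add_mem (IntermediateField.subset_adjoin _ _ (Or.inl ⟨i, rfl⟩)) (hL _ (hw i).1)
  · simp only [SetLike.mem_coe, Function.comp_apply, Pi.add_apply, Complex.exp_add]
    exact K.mul_mem (IntermediateField.subset_adjoin _ _ (Or.inr ⟨i, rfl⟩)) (hL _ (hw i).2)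

theorem adjoin_translate_eq (L : IntermediateField ℚ ℂ) {n : ℕ} (z w : Fin n → ℂ)
    (hw : ∀ i, w i ∈ L ∧ Complex.exp (w i) ∈ L) :
    IntermediateField.adjoin L (range (z + w) ∪ range (Complex.exp ∘ (z + w))) =
      IntermediateField.adjoin L (range z ∪ range (Complex.exp ∘ z)) := by
  refine le_antisymm (adjoin_translate_le L z w hw) ?_
  have hw' : ∀ i, (-w) i ∈ L ∧ Complex.exp ((-w) i) ∈ L := fun i =>
    ⟨L.neg_mem (hw i).1, by rw [Pi.neg_apply, Complex.exp_neg]; exact L.inv_mem (hw i).2⟩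
  simpa using adjoin_translate_le L (z + w) (-w) hw'

/-- Translation by a core tuple changes neither side of `C`. -/
theorem core_translate_invariant {n : ℕ} (z : Fin n → ℂ) (a : Fin n → ℝ)
    (ha : ∀ i, a i ∈ ecl (∅ : Set ℝ)) :
    coreSpan.mkQ ∘ (z + fun i => ((a i : ℝ) : ℂ)) = coreSpan.mkQ ∘ z ∧
    IntermediateField.adjoin coreField
        (range (z + fun i => ((a i : ℝ) : ℂ)) ∪ range (Complex.exp ∘ (z + fun i => ((a i : ℝ) : ℂ)))) =
      IntermediateField.adjoin coreField (range z ∪ range (Complex.exp ∘ z)) := by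
  refine ⟨?_, adjoin_translate_eq coreField z _ fun i => ?_⟩
  · funext i
    simp only [Function.comp_apply, Pi.add_apply, Submodule.mkQ_apply, Submodule.Quotient.mk_add,
      add_eq_left]
    exact (Submodule.Quotient.mk_eq_zero _).mpr (Submodule.subset_span ⟨a i, ha i, rfl⟩)
  · exact ⟨IntermediateField.subset_adjoin ℚ coreC ⟨a i, ha i, rfl⟩,
      IntermediateField.subset_adjoin ℚ coreC ⟨Real.exp (a i), Khovanskii.exp_mem_ecl (ha i),
        Complex.ofReal_exp (a i)⟩⟩

/-- Consequently the `n`-th instance of `C` at `z + a` is the instance at `z`, verbatim. -/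
theorem relOverRealCore_instance_translate {n : ℕ} (z : Fin n → ℂ) (a : Fin n → ℝ)
    (ha : ∀ i, a i ∈ ecl (∅ : Set ℝ)) :
    (LinearIndependent ℚ (coreSpan.mkQ ∘ (z + fun i => ((a i : ℝ) : ℂ))) →
        (n : Cardinal) ≤ Algebra.trdeg coreField ↥(IntermediateField.adjoin coreField
          (range (z + fun i => ((a i : ℝ) : ℂ)) ∪
            range (Complex.exp ∘ (z + fun i => ((a i : ℝ) : ℂ)))))) ↔
    (LinearIndependent ℚ (coreSpan.mkQ ∘ z) →
        (n : Cardinal) ≤ Algebra.trdeg coreField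
          ↥(IntermediateField.adjoin coreField (range z ∪ range (Complex.exp ∘ z)))) := by
  obtain ⟨h1, h2⟩ := core_translate_invariant z a ha
  rw [h1, h2]

#print axioms relOverRealCore_instance_translate

end Summit.Schanuel.Schanuel.Cruxes.RelOverRealCore.Disproof
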